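/- Copyright: the b2b-balaban cell (near-miss cell 7), T⁴-continuum fan-out, lineage t4-ne7b-p1 (node U5c COUNT
member).  Released under the licence of the surrounding project. -/
import Summits.QuantumFields.BalabanUV.T4Continuum.Support.HistoryGenealogyPedigreeRoot
import Summits.QuantumFields.BalabanUV.T4Continuum.Support.HistoryGenealogyInstantiateMClauses

/-!
# THE JUNCTION (M4, brick 3b): print's level-by-level construction of the large-field components — memory-generic form
`RunInputM` — READ IN THE END's CURRENCY: its pedigree satisfies the seven fields `renew_step` ∕ `forest` ∕ `headOldest`
∕ `real` ∕ `track` ∕ `disjoint` ∕ `inBox` of the memory-agnostic carriers, for every cutoff (owner module of row NE7b,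
lineage `t4-ne7b-p1` gen 41; re-open object (α), `SCOPE-alpha.md` v2.3 §5 row M4 — PRE-POSITIONING ONLY)

Summits-side support leaf of the T⁴-continuum cell (rung (B)+1 on a FINITE torus only; NOT infinite volume, NOT the
mass gap, NOT the Clay statement; NOT a proof of the spine estimate NE7b, which is the cell's OWN estimate, NOT PRINTED
and NOT PROVED).  [folklore] finite combinatorics in the ℤᵈ index model: parts 1–6 of this brick (`pedOf`, `ordOf`,
`forest_pedOf_ordOf`, `headOldest_pedOf_ordOf`, `realisesW_toPGen_ordOf`, `anchorAt_toPGen_mem_edomR`,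
`rootCell_toPGen_mem_newReg`, displayed `NoFreshClusters`∕`CoverOK`), leaf-05's memory-generic process
`HistoryGenealogyInstantiateM*` (`RunInputM`, `histM`, `rnwM`, `wf_histM`, `levelClausesW_histM`, `invM`,
`StM_nonempty_disjoint`), leaf-01's memory kit (`StopsM`, `stopsM_of_stops`) and leaf-08's `HistoryRealiseCells`
(`anchorAt`, `curDomain`, `levelOf`); nothing printed is asserted, no `def … : Prop` fact of Bałaban's, zero `sorry`.
B15 p. 177 ∕ B16 pp. 383–387 under audit; locators only.

WHY.  The END of the COUNT road reads, for every cutoff `K` and term, a `Pedigree` with payload map `cellP`, live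
components `liveC`, last-event domains `Z`, and asks seven fields (`HistoryRealiseWeakCells.RealisedDomainsW`, IR-41-4;
shapes fixed since `HistoryRealiseCells.RealisedDomains`, p210682).  Row S15∕S15-M DEFINE print's process (B16 pp.
383–387 read as construction rules: alive∕ready∕renewed lines, S-images, touch-components, (1.84)) for ANY readiness
memory `Rm` dominated by the frozen one (`Rm t k ≤ R t`: print's current memory `R (t + k)` for non-increasing `R`, B15
p. 177; the landed frozen model with equality).  THIS FILE instantiates bricks 2–3a on that process — `pedM I := pedOf
I.histM I.rnwM (ordOf …)`, `cellP := id`, `liveC K := I.histM.comp K`, `Z K := edomR … K` — and proves the seven field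
SHAPES, component by component: `renew_step_pedM`, `forest_pedM`, `headOldest_pedM` (under the displayed «no fresh
clusters», located open point G-M4-1), **`real_pedM`** (`RealisesW … ∧ PendingBefore … K` — pendency at the cutoff from
the invariant `invM` by memory domination), **`track_pedM`** (`CoverOK` DISCHARGED for the process: the domain IS the union
of the images), **`disjoint_pedM`** (distinct live lines have disjoint domains), **`inBox_pedM`** (from a displayed box
condition on the new regions — the torus placement is M2's input).  What remains for the END is M2 (the term family
and its weights) and the packaging into `RealisedDomainsRW` once IR-41-4 lands it.

HONEST.  Proves nothing of Bałaban's; the identification of `RunInputM`'s inputs with the admissible sequences of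
(2.18)[III]∕(1.72)[V] is M2's residual reading; `NoFreshClusters` and the box condition are DISPLAYED; NE7b NOT proved;
spine 0∕9.  HONEST DEPENDENCY (cell): continuum YM on T⁴ ⇐ BetaPertH ∧ nine spine estimates (0/9 proved); BetaPertH ⇐
(D1) ∧ (D4) ∧ CAP+tail; G-an2-4 gates asym, D1 and NE2/3/4.  This file changes none of it. -/

open Finset
open Literature.MathematicalPhysics.QuantumFieldTheory.Balaban1983to89
open Literature.MathematicalPhysics.QuantumFieldTheory.Balaban1983to89.B13ScaleTransfer
open Literature.MathematicalPhysics.QuantumFieldTheory.Balaban1983to89.B16SProfile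
open Literature.MathematicalPhysics.QuantumFieldTheory.Balaban1983to89.B16MergeGeometry
open T4PersistenceDictionary
open Summit.QuantumFields.BalabanUV.T4Continuum.HistoryAdmissible
open Summit.QuantumFields.BalabanUV.T4Continuum.HistoryRealise
open Summit.QuantumFields.BalabanUV.T4Continuum.HistoryRealisePrint
open Summit.QuantumFields.BalabanUV.T4Continuum.HistoryRealiseWeak
open Summit.QuantumFields.BalabanUV.T4Continuum.HistoryRealiseMemory
open Summit.QuantumFields.BalabanUV.T4Continuum.HistoryRealiseCells
open Summit.QuantumFields.BalabanUV.T4Continuum.HistoryZones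
open Summit.QuantumFields.BalabanUV.T4Continuum.HistoryGen
open Summit.QuantumFields.BalabanUV.T4Continuum.HistoryGenealogyExtraction
open Summit.QuantumFields.BalabanUV.T4Continuum.HistoryGenealogyRealise
open Summit.QuantumFields.BalabanUV.T4Continuum.HistoryGenealogyRealise.GeomHistoryR
open Summit.QuantumFields.BalabanUV.T4Continuum.HistoryGenealogyInstantiate
open Summit.QuantumFields.BalabanUV.T4Continuum.HistoryGenealogyPedigree

namespace Summit.QuantumFields.BalabanUV.T4Continuum.HistoryGenealogyInstantiate

noncomputable section

open Classical

variable {d : ℕ}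

namespace RunInputM

variable (I : RunInputM d)

/-! ## §1 The pedigree of the process, its last-event domains, and the cover condition discharged -/

/-- the chosen (oldest-first contact) order of the constituents of the process's components [folklore] -/
def ordM : ℕ → Lab d → List (Lab d ⊕ Lab d) := ordOf I.histM I.rnwM RunInput.domL I.L I.s

/-- **THE PEDIGREE OF THE PROCESS** in the END's currency (names `(level, label)`, payloads = new regions). [folklore] -/
def pedM : Pedigree (ℕ × Lab d) (Lab d) := pedOf I.histM I.rnwM I.ordM

/-- the LAST-EVENT DOMAIN of the component labelled `c` at level `K` [folklore] -/
def ZM (K : ℕ) (c : Lab d) : Finset (Pt d) := edomR I.histM I.rnwM RunInput.domL K c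

/-- **THE COVER CONDITION HOLDS FOR THE PROCESS**: a component's domain IS the union of its constituents' images, so it
contains each of them. [folklore] -/
theorem coverOK_histM (hN : I.NewOK) : CoverOK I.histM RunInput.domL I.L I.s := by
  intro j c hc q hq
  obtain ⟨T, hT, rfl⟩ := I.mem_compM_iff.1 hc
  rw [I.constit_lab_newLineM hN hT] at hq
  obtain ⟨x, hx, rfl⟩ := List.mem_map.1 hq
  have hxT : x ∈ T := ((I.enumBM_spec hT).2.1 x).1 hx
  rw [← RunInput.P_eq_imgC, show RunInput.domL j (lab (I.newLineM j T)) = fam (I.P j) T by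
    rw [I.lab_newLineM]; rfl]
  exact subset_fam (I.P j) hxT

/-! ## §2 The three encoding fields -/

/-- **`renew_step`** for the process's pedigree (every name). [folklore] -/
theorem renew_step_pedM (c c' : ℕ × Lab d) (h : Part.old c' true ∈ I.pedM.parts c) : I.pedM.step c' + 1 = I.pedM.step c :=
  renew_step_pedOf I.histM I.rnwM I.ordM c c' h

/-- **`forest`** for the process's pedigree (every name). [folklore] -/
theorem forest_pedM (hN : I.NewOK) (hRm : ∀ t k, I.Rm t k ≤ I.R t) (c : ℕ × Lab d) : I.pedM.Forest c :=
  forest_pedOf_ordOf (I.wf_histM hN) (I.levelClausesW_histM hN hRm) c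

/-- **`headOldest`** for the process's pedigree (every name), under the displayed «no fresh clusters» condition
(located open point G-M4-1). [folklore] -/
theorem headOldest_pedM (hN : I.NewOK) (hRm : ∀ t k, I.Rm t k ≤ I.R t) (hNF : NoFreshClusters I.histM) (c : ℕ × Lab d) :
    I.pedM.HeadOldest c :=
  headOldest_pedOf_ordOf (I.wf_histM hN) (I.levelClausesW_histM hN hRm) hNF c

/-! ## §3 `real`: realised and pending strictly before the cutoff -/

/-- every live component is `RealisesW`-realised by its last-event domain [folklore] -/
theorem realisesW_pedM (hN : I.NewOK) (hRm : ∀ t k, I.Rm t k ≤ I.R t) {K : ℕ} {c : Lab d} (hc : c ∈ I.histM.comp K) :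
    RealisesW I.L I.s I.R (I.pedM.toPGen id (K, c)) (I.ZM K c) :=
  (realisesW_toPGen_ordOf (I.wf_histM hN) (I.levelClausesW_histM hN hRm) hc).1

/-- the current domain of a live component is the orbit of its last-event domain from its last step [folklore] -/
theorem domL_eq_curDomain_pedM (hN : I.NewOK) (hRm : ∀ t k, I.Rm t k ≤ I.R t) {K : ℕ} {c : Lab d}
    (hc : c ∈ I.histM.comp K) : c.2 = curDomain I.L I.s (I.pedM.toPGen id (K, c)) (I.ZM K c) K :=
  (realisesW_toPGen_ordOf (I.wf_histM hN) (I.levelClausesW_histM hN hRm) hc).2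

/-- **every live component is pending STRICTLY BEFORE the cutoff** (frozen memory): the live line has not been
`Rm`-ready since its last event (`invM`), and `Rm`-unreadiness dominates frozen unreadiness. [folklore] -/
theorem pendingBefore_pedM (hN : I.NewOK) (hRm : ∀ t k, I.Rm t k ≤ I.R t) {K : ℕ} {c : Lab d}
    (hc : c ∈ I.histM.comp K) : PendingBefore I.L I.s I.R (I.pedM.toPGen id (K, c)).lastStep (I.ZM K c) K := by
  obtain ⟨τ, hτ, rfl⟩ : ∃ τ ∈ I.StM K, lab τ = c := by
    have : c ∈ (I.StM K).image lab := hc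
    simpa only [Finset.mem_image] using this
  obtain ⟨hle, ht, hE, hpend⟩ := I.invM hN K τ hτ
  have hlast : (I.pedM.toPGen id (K, lab τ)).lastStep = (I.histM.pgenR I.rnwM K (lab τ)).lastStep :=
    (lastStep_toPGen_ordOf (I.wf_histM hN) (I.levelClausesW_histM hN hRm) hc).1
  refine ⟨by rw [hlast, ← ht]; exact hle, fun k hk => ?_⟩
  rw [hlast, ← ht] at hk ⊢
  show ¬ Stops I.L I.s I.R τ.t (edomR I.histM I.rnwM RunInput.domL K (lab τ)) k
  rw [← hE]
  exact I.not_stops_of_not_stopsM hRm (hpend k hk)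

/-- **`real`** for the process: every live component is weakly realised by its last-event domain and pending strictly
before the cutoff. [folklore] -/
theorem real_pedM (hN : I.NewOK) (hRm : ∀ t k, I.Rm t k ≤ I.R t) {K : ℕ} {c : Lab d} (hc : c ∈ I.histM.comp K) :
    RealisesW I.L I.s I.R (I.pedM.toPGen id (K, c)) (I.ZM K c) ∧
      PendingBefore I.L I.s I.R (I.pedM.toPGen id (K, c)).lastStep (I.ZM K c) K :=
  ⟨I.realisesW_pedM hN hRm hc, I.pendingBefore_pedM hN hRm hc⟩

/-! ## §4 `track`, `disjoint`, `inBox` -/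

/-- **`track`** for the process: the last-event domain contains the root anchor re-blocked to the last step. [folklore] -/
theorem track_pedM (hN : I.NewOK) (hRm : ∀ t k, I.Rm t k ≤ I.R t) {K : ℕ} {c : Lab d} (hc : c ∈ I.histM.comp K) :
    anchorAt I.L I.s (I.pedM.toPGen id (K, c)) (I.pedM.toPGen id (K, c)).lastStep ∈ I.ZM K c :=
  anchorAt_toPGen_mem_edomR (I.wf_histM hN) (I.levelClausesW_histM hN hRm) (I.coverOK_histM hN) K c hc

/-- the re-blocked root anchor lies in the current domain at the cutoff [folklore] -/
theorem anchorAt_mem_curDomain_pedM (hN : I.NewOK) (hRm : ∀ t k, I.Rm t k ≤ I.R t) {K : ℕ} {c : Lab d}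
    (hc : c ∈ I.histM.comp K) :
    anchorAt I.L I.s (I.pedM.toPGen id (K, c)) K ∈ curDomain I.L I.s (I.pedM.toPGen id (K, c)) (I.ZM K c) K :=
  anchorAt_mem_curDomain I.L I.s (I.track_pedM hN hRm hc)
    (rootStep_le_lastStep_of_realisesW (I.realisesW_pedM hN hRm hc))
    (lastStep_toPGen_ordOf (I.wf_histM hN) (I.levelClausesW_histM hN hRm) hc).2

/-- **`disjoint`** for the process: distinct live components have disjoint current domains at the cutoff. [folklore] -/
theorem disjoint_pedM (hN : I.NewOK) (hRm : ∀ t k, I.Rm t k ≤ I.R t) {K : ℕ} {c c' : Lab d} (hc : c ∈ I.histM.comp K)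
    (hc' : c' ∈ I.histM.comp K) (hne : c ≠ c') :
    Disjoint (curDomain I.L I.s (I.pedM.toPGen id (K, c)) (I.ZM K c) K)
      (curDomain I.L I.s (I.pedM.toPGen id (K, c')) (I.ZM K c') K) := by
  rw [← I.domL_eq_curDomain_pedM hN hRm hc, ← I.domL_eq_curDomain_pedM hN hRm hc']
  obtain ⟨τ, hτ, rfl⟩ : ∃ τ ∈ I.StM K, lab τ = c := by
    have : c ∈ (I.StM K).image lab := hc
    simpa only [Finset.mem_image] using this
  obtain ⟨τ', hτ', rfl⟩ : ∃ τ' ∈ I.StM K, lab τ' = c' := by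
    have : c' ∈ (I.StM K).image lab := hc'
    simpa only [Finset.mem_image] using this
  have hne' : τ ≠ τ' := fun h => hne (by rw [h])
  simpa only [lab_snd] using (I.StM_nonempty_disjoint hN K).2 τ hτ τ' hτ' hne'

/-- the root cell of a live component is a new region of the input, born at the root step `≤ K` [folklore] -/
theorem rootCell_pedM_mem_N (hN : I.NewOK) (hRm : ∀ t k, I.Rm t k ≤ I.R t) {K : ℕ} {c : Lab d} (hc : c ∈ I.histM.comp K) :
    (I.pedM.toPGen id (K, c)).rootStep ≤ K ∧ (I.pedM.toPGen id (K, c)).rootCell ∈ I.N (I.pedM.toPGen id (K, c)).rootStep :=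
  rootCell_toPGen_mem_newReg (I.wf_histM hN) (I.levelClausesW_histM hN hRm) K c hc

/-- **THE DISPLAYED BOX CONDITION** on the input up to the cutoff `K`: every new region of level `j ≤ K` has its anchor
inside the period box of the `n·L^K` torus at the blocking level of `j` (the torus placement of print's regions —
supplied by M2 from the torus setting; here a hypothesis shape). [folklore] -/
def InBoxOK (n K : ℕ) : Prop :=
  ∀ j, j ≤ K → ∀ nr ∈ I.N j, ∀ i, 0 ≤ nr.1 i ∧ I.L ^ levelOf I.s K j * (nr.1 i).toNat < n * I.L ^ K

/-- **`inBox`** for the process, from the displayed box condition. [folklore] -/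
theorem inBox_pedM (hN : I.NewOK) (hRm : ∀ t k, I.Rm t k ≤ I.R t) {n K : ℕ} (hbox : I.InBoxOK n K) {c : Lab d}
    (hc : c ∈ I.histM.comp K) (i : Fin d) :
    0 ≤ rootAnchor (I.pedM.toPGen id (K, c)) i ∧
      I.L ^ levelOf I.s K (I.pedM.toPGen id (K, c)).rootStep * (rootAnchor (I.pedM.toPGen id (K, c)) i).toNat <
        n * I.L ^ K := by
  obtain ⟨hle, hmem⟩ := I.rootCell_pedM_mem_N hN hRm hc
  exact hbox _ hle _ hmem i

/-! ## §5 The seven fields at one cutoff, packaged -/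

/-- **THE JUNCTION AT A CUTOFF**: the seven `RealisedDomainsW`-field shapes for the process's pedigree at cutoff `K`
(payload map `id`, live set `I.histM.comp K`, last-event domains `ZM K`), under `NewOK`, memory domination, «no fresh
clusters» and the box condition. [folklore] -/
theorem junction_pedM (hN : I.NewOK) (hRm : ∀ t k, I.Rm t k ≤ I.R t) (hNF : NoFreshClusters I.histM) {n K : ℕ}
    (hbox : I.InBoxOK n K) :
    (∀ c c', Part.old c' true ∈ I.pedM.parts c → I.pedM.step c' + 1 = I.pedM.step c) ∧
    (∀ c, I.pedM.Forest c) ∧ (∀ c, I.pedM.HeadOldest c) ∧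
    (∀ c ∈ I.histM.comp K,
      RealisesW I.L I.s I.R (I.pedM.toPGen id (K, c)) (I.ZM K c) ∧
        PendingBefore I.L I.s I.R (I.pedM.toPGen id (K, c)).lastStep (I.ZM K c) K) ∧
    (∀ c ∈ I.histM.comp K, anchorAt I.L I.s (I.pedM.toPGen id (K, c)) (I.pedM.toPGen id (K, c)).lastStep ∈ I.ZM K c) ∧
    (∀ c ∈ I.histM.comp K, ∀ c' ∈ I.histM.comp K, c ≠ c' →
      Disjoint (curDomain I.L I.s (I.pedM.toPGen id (K, c)) (I.ZM K c) K)
        (curDomain I.L I.s (I.pedM.toPGen id (K, c')) (I.ZM K c') K)) ∧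
    (∀ c ∈ I.histM.comp K, ∀ i, 0 ≤ rootAnchor (I.pedM.toPGen id (K, c)) i ∧
      I.L ^ levelOf I.s K (I.pedM.toPGen id (K, c)).rootStep * (rootAnchor (I.pedM.toPGen id (K, c)) i).toNat <
        n * I.L ^ K) :=
  ⟨I.renew_step_pedM, I.forest_pedM hN hRm, I.headOldest_pedM hN hRm hNF, fun _ hc => I.real_pedM hN hRm hc,
    fun _ hc => I.track_pedM hN hRm hc, fun _ hc _ hc' hne => I.disjoint_pedM hN hRm hc hc' hne,
    fun _ hc i => I.inBox_pedM hN hRm hbox hc i⟩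

end RunInputM

end

end Summit.QuantumFields.BalabanUV.T4Continuum.HistoryGenealogyInstantiate
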